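import Summits.ABC.IUTFork.Conditional.AbcOfSHvolGenuineFamily
import Literature.IUT.LogVolume.Corollary22PartIIPointwise
import HarnessLib

/-!
# Branch C, TARGET #1 — preliminaries for the refutation of the CONE binder `hvol` / `hreg` on the admissible degree-2 family
# (abc-iut cell, R2 S-chain team, seat abc-iut-s2-p5 gen 2; crux ThetaPartII = stmt-ABC-19678)

Record-only PROOF file (D-0012) of the abc-iut cell; TAKES NO SIDE on [IUTchIII] Cor. 3.12, on [IUTchIV] Thm. 1.10 or on any
author. Part 1 of `Conditional/AbcOfSHvolRefutation` (kept apart for the 400-line discipline): the classical real analysis and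
the place-transport bookkeeping used there. S. Mochizuki, *IUT IV* [Mochizuki2012], Thm. 1.10 proof Step (v) pp. 27–28; Cor. 2.2
(i)–(ii) pp. 41–46; Dupuy–Hilado [DupuyHilado2025] §3.3, §3.6. [claim: Mochizuki2012, status: disputed] for every IUT quotation.

* `exists_sqrt_log_lt_linear` — growth rates: `C₀ + C₁·√h + C₂·√h·log(M·h) < κ·h` for `h ≥ H₁` (`log x ≤ 4·x^{1/4}`, Mathlib
  `Real.log_le_rpow_div`); [folklore];
* `PointDict.logCondAvoid_le_logQForall` — `log𝔣^{F_tpd}_{∤S}(λ) ≤ log(q^∀(λ))` (every pole of `j(λ)` has local height `≥ 1`);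
* `PointDict.half_le_goodWeightSum` / `PointDict.mul_log_le_badHeightSum` — at a prime `p` carrying a place `W` of `F_tpd = ℚ(j(λ))`
  with no pole of `j(λ)` and weight `1/2`, resp. a place `V ∤ 2l` with `ord_V j(λ) ≤ −2k`, weight `1/2`, `n_V = 1`, `N(V) = p`: the
  good-weight sum of the (P5)-bad predicate over the places of `ℚ(j(λ))` above `p` is `≥ 1/2`, and the `Pr`-weighted bad
  local-height sum is `≥ k·log p` (transport along abc-iut-s2-p3's `weight_finBelow_eq_of_adjoin_eq_top` and abc-iut-s2-p5 gen 0's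
  `ord_mul_logNorm_div_localDegree_algebraMap`) — these are the two place sums of abc-iut-s2-p1 gen 2's sharp necessity
  (`LDHSlotRegimePointNecessitySharpFree`, p446116) at `W = {p}`;
* `PointDict.sharp_violation_real` — the real-arithmetic endgame: with `d = 2`, `l ≥ 11`, `lC ≤ h`, `h^{1/2} ≤ l ≤ 10δ·h^{1/2}·log(2δh)`,
  `h ≤ A + B·k`, `k·log 7 ≤ S`, `1/2 ≤ ω`, `E ≤ 34δl + 52` and the growth inequality, the sharp slack
  `(4d − 1 + 3d/l)(lD + lC) + ((l+5−4d)/(4l))·lC + ((l+1)/4)·E` is STRICTLY below `(1/(2l))·S·(l(l+1)/12 − 4(1−ω)/((l−1)ω³))`.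

Nothing here mentions a Θ-datum; nothing asserted about any point, about print, or about any author; typed ≠ proved.
PROOF-ONLY file: no definitions, no named `Prop` facts. [cite: Mochizuki2012, IUTchIV Thm. 1.10 proof Step (v) p. 27–28]
[cite: Mochizuki2012, IUTchIV Cor. 2.2 (i) p. 41] [cite: DupuyHilado2025, §3.3, §3.6] [cite: NeukirchANT1999, Ch. I §8]
-/

noncomputable section

namespace Summit.ABC.IUTFork

open NumberField IsDedekindDomain Literature.IUT.LogVolume Literature.IUT.HodgeTheaters
open Literature.NumberTheory.DiophantineGeometry.GenEll Literature.NumberTheory.NumberFields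
open scoped Classical

/-! ## §1. Real analysis: `C₀ + C₁·√h + C₂·√h·log(M·h) < κ·h` for large `h` -/

/-- **Growth rates**: for `C₂ ≥ 0`, `M > 0`, `κ > 0` there is `H₁ ≥ 1` with `C₀ + C₁·√h + C₂·√h·log(M·h) < κ·h` for all `h ≥ H₁`
(`log x ≤ 4·x^{1/4}`, so the left side is `≤ K·h^{3/4}` with `K = |C₀| + |C₁| + 4·C₂·M^{1/4}`; take `h^{1/4} > K/κ`). [folklore] -/
theorem exists_sqrt_log_lt_linear (C₀ C₁ C₂ M κ : ℝ) (hC₂ : 0 ≤ C₂) (hM : 0 < M) (hκ : 0 < κ) :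
    ∃ H₁ : ℝ, 1 ≤ H₁ ∧ ∀ h : ℝ, H₁ ≤ h →
      C₀ + C₁ * Real.sqrt h + C₂ * Real.sqrt h * Real.log (M * h) < κ * h := by
  have hM4 : 0 ≤ M ^ ((1 : ℝ) / 4) := Real.rpow_nonneg hM.le _
  set K : ℝ := |C₀| + |C₁| + 4 * C₂ * M ^ ((1 : ℝ) / 4) with hK
  have hK0 : 0 ≤ K := by positivity
  refine ⟨max 1 ((K / κ + 1) ^ 4), le_max_left _ _, fun h hh => ?_⟩
  have h1 : 1 ≤ h := (le_max_left _ _).trans hh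
  have h0 : 0 < h := by linarith
  -- `h^{1/4} > K/κ`
  have hq : K / κ < h ^ ((1 : ℝ) / 4) := by
    have hb : 0 ≤ K / κ + 1 := by positivity
    have e : ((K / κ + 1) ^ 4) ^ ((1 : ℝ) / 4) = K / κ + 1 := by
      rw [show ((1 : ℝ) / 4) = ((4 : ℕ) : ℝ)⁻¹ by norm_num]
      exact Real.pow_rpow_inv_natCast hb (by norm_num)
    have hle : ((K / κ + 1) ^ 4) ^ ((1 : ℝ) / 4) ≤ h ^ ((1 : ℝ) / 4) :=
      Real.rpow_le_rpow (by positivity) ((le_max_right _ _).trans hh) (by norm_num)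
    rw [e] at hle
    linarith
  -- every term is `≤ const · h^{3/4}`
  have h34 : 1 ≤ h ^ ((3 : ℝ) / 4) := Real.one_le_rpow h1 (by norm_num)
  have hs : Real.sqrt h = h ^ ((1 : ℝ) / 2) := Real.sqrt_eq_rpow h
  have hs34 : Real.sqrt h ≤ h ^ ((3 : ℝ) / 4) := by
    rw [hs]; exact Real.rpow_le_rpow_of_exponent_le h1 (by norm_num)
  have hs0 : 0 ≤ Real.sqrt h := Real.sqrt_nonneg h
  have hlog : Real.log (M * h) ≤ 4 * M ^ ((1 : ℝ) / 4) * h ^ ((1 : ℝ) / 4) := by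
    have hx := Real.log_le_rpow_div (x := M * h) (ε := (1 : ℝ) / 4) (by positivity) (by norm_num)
    rw [Real.mul_rpow hM.le h0.le] at hx
    have e : M ^ ((1 : ℝ) / 4) * h ^ ((1 : ℝ) / 4) / ((1 : ℝ) / 4) = 4 * M ^ ((1 : ℝ) / 4) * h ^ ((1 : ℝ) / 4) := by
      ring
    linarith
  have hprod : Real.sqrt h * Real.log (M * h) ≤ 4 * M ^ ((1 : ℝ) / 4) * h ^ ((3 : ℝ) / 4) := by
    calc Real.sqrt h * Real.log (M * h) ≤ Real.sqrt h * (4 * M ^ ((1 : ℝ) / 4) * h ^ ((1 : ℝ) / 4)) :=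
          mul_le_mul_of_nonneg_left hlog hs0
      _ = 4 * M ^ ((1 : ℝ) / 4) * (h ^ ((1 : ℝ) / 2) * h ^ ((1 : ℝ) / 4)) := by rw [hs]; ring
      _ = 4 * M ^ ((1 : ℝ) / 4) * h ^ ((3 : ℝ) / 4) := by rw [← Real.rpow_add h0]; norm_num
  have hA : C₀ ≤ |C₀| * h ^ ((3 : ℝ) / 4) :=
    (le_abs_self C₀).trans (le_mul_of_one_le_right (abs_nonneg _) h34)
  have hB : C₁ * Real.sqrt h ≤ |C₁| * h ^ ((3 : ℝ) / 4) :=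
    (mul_le_mul_of_nonneg_right (le_abs_self C₁) hs0).trans (mul_le_mul_of_nonneg_left hs34 (abs_nonneg _))
  have hC : C₂ * Real.sqrt h * Real.log (M * h) ≤ 4 * C₂ * M ^ ((1 : ℝ) / 4) * h ^ ((3 : ℝ) / 4) := by
    have := mul_le_mul_of_nonneg_left hprod hC₂
    have e : C₂ * (4 * M ^ ((1 : ℝ) / 4) * h ^ ((3 : ℝ) / 4)) = 4 * C₂ * M ^ ((1 : ℝ) / 4) * h ^ ((3 : ℝ) / 4) := by
      ring
    rw [mul_assoc, ← e]
    exact this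
  -- `K·h^{3/4} < κ·h`
  have hh34 : 0 < h ^ ((3 : ℝ) / 4) := Real.rpow_pos_of_pos h0 _
  have hsplit : h = h ^ ((3 : ℝ) / 4) * h ^ ((1 : ℝ) / 4) := by
    rw [← Real.rpow_add h0]; norm_num
  have e : κ * h = κ * h ^ ((1 : ℝ) / 4) * h ^ ((3 : ℝ) / 4) := by
    conv_lhs => rw [hsplit]
    ring
  have hKlt : K < κ * h ^ ((1 : ℝ) / 4) := by
    have := (div_lt_iff₀ hκ).mp hq
    linarith
  have hfin : K * h ^ ((3 : ℝ) / 4) < κ * h := by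
    rw [e]
    exact mul_lt_mul_of_pos_right hKlt hh34
  have eK : K * h ^ ((3 : ℝ) / 4) =
      |C₀| * h ^ ((3 : ℝ) / 4) + |C₁| * h ^ ((3 : ℝ) / 4) + 4 * C₂ * M ^ ((1 : ℝ) / 4) * h ^ ((3 : ℝ) / 4) := by
    rw [hK]; ring
  have hsum : C₀ + C₁ * Real.sqrt h + C₂ * Real.sqrt h * Real.log (M * h) ≤ K * h ^ ((3 : ℝ) / 4) := by
    rw [eK]; linarith
  exact lt_of_le_of_lt hsum hfin

namespace PointDict

variable {P : NFPoint} {l : ℕ}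

/-! ## §2. `log𝔣^{∤S} ≤ log(q^∀)` and the two place sums at a split prime of `ℚ(j(λ)) = F_tpd` -/

/-- **`log𝔣^{F_tpd}_{∤S}(λ) ≤ log(q^∀(λ))`**: the conductor divisor away from `S` has coefficient `1 ≤ h_v = −ord_v j(λ)` at every
bad place, and the `q`-parameter divisor only grows when `S` shrinks to `∅` (`Cor22.logQAvoid_anti`).
[cite: Mochizuki2012, IUTchIV Cor. 2.2 (i) p. 41] [claim: Mochizuki2012, status: disputed] -/
theorem logCondAvoid_le_logQForall (P : NFPoint) (S : Finset ℕ) :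
    Cor22.logCondAvoid P S ≤ Cor22.logQForall P := by
  classical
  have hdeg : (0 : ℝ) < (P.degree : ℝ) := by exact_mod_cast P.degree_pos
  have h1 : (P.degree : ℝ) * Cor22.logCondAvoid P S = ∑ v ∈ Cor22.badPlacesAvoid P S, logNorm P.F v := by
    rw [Cor22.logCondAvoid_eq_sum, ← mul_assoc, mul_inv_cancel₀ hdeg.ne', one_mul]
    rfl
  have h2 : (P.degree : ℝ) * Cor22.logQAvoid P S =
      ∑ v ∈ Cor22.badPlacesAvoid P S, Cor22.localHeight P v * logNorm P.F v :=
    Cor22.degree_mul_logQAvoid P S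
  have hle : (P.degree : ℝ) * Cor22.logCondAvoid P S ≤ (P.degree : ℝ) * Cor22.logQAvoid P S := by
    rw [h1, h2]
    refine Finset.sum_le_sum fun v hv => ?_
    have hvb : v ∈ Cor22.badPlaces P := Cor22.badPlacesAvoid_subset P S hv
    have hord := (Cor22.mem_badPlaces_iff_ord_neg P v).mp hvb
    have h1le : (1 : ℝ) ≤ Cor22.localHeight P v := by
      rw [Cor22.localHeight_eq_neg_ord hvb]
      have : (1 : ℤ) ≤ -ord P.F v (Cor22.jInv P.x) := by omega
      exact_mod_cast this
    calc logNorm P.F v = 1 * logNorm P.F v := (one_mul _).symm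
      _ ≤ Cor22.localHeight P v * logNorm P.F v := mul_le_mul_of_nonneg_right h1le (logNorm_pos P.F v).le
  exact (le_of_mul_le_mul_left hle hdeg).trans (Cor22.logQAvoid_anti P (Finset.empty_subset S))

/-- **The good-weight sum at a split prime is `≥ 1/2`.** For `P = (F_tpd, λ)` with `ℚ(j(λ)) = F_tpd` and a place `W` of `F_tpd` over
`p` of weight `1/2` at which `j(λ)` has no pole, the `Pr`-mass of the non-(P5)-bad places of `ℚ(j(λ))` over `p` is at least `1/2`
(the restriction of `W`; weights descend along the one-point fibres, abc-iut-s2-p3's `weight_finBelow_eq_of_adjoin_eq_top`).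
[cite: DupuyHilado2025, §3.6] [cite: NeukirchANT1999, Ch. I §8] -/
theorem half_le_goodWeightSum (htop : IntermediateField.adjoin ℚ ({Cor22.jInv P.x} : Set P.F) = ⊤)
    {p : ℕ} [Fact p.Prime] {W : HeightOneSpectrum (𝓞 P.F)} (hW : W ∈ placesOver P.F p)
    (hWj : 0 ≤ ord P.F W (Cor22.jInv P.x)) (hw : weight P.F W = 1 / 2) (l : ℕ) :
    (1 / 2 : ℝ) ≤ ∑ V ∈ Finset.univ.filter
        (fun V : placesOver ↥(IntermediateField.adjoin ℚ ({Cor22.jInv P.x} : Set P.F)) p =>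
          ¬ (ord _ V.1 (Cor22.jMod P) < 0 ∧ ((2 : ℕ) : 𝓞 _) ∉ V.1.asIdeal ∧ ((l : ℕ) : 𝓞 _) ∉ V.1.asIdeal)),
        weight _ V.1 := by
  set Fm : Type := ↥(IntermediateField.adjoin ℚ ({Cor22.jInv P.x} : Set P.F)) with hFm
  let w : placesOver Fm p := ⟨finBelow Fm P.F W, finBelow_mem_placesOver Fm P.F hW⟩
  have hj : algebraMap Fm P.F (Cor22.jMod P) = Cor22.jInv P.x := rfl
  have hwgood : w ∈ Finset.univ.filter (fun V : placesOver Fm p =>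
      ¬ (ord Fm V.1 (Cor22.jMod P) < 0 ∧ ((2 : ℕ) : 𝓞 Fm) ∉ V.1.asIdeal ∧ ((l : ℕ) : 𝓞 Fm) ∉ V.1.asIdeal)) := by
    rw [Finset.mem_filter]
    refine ⟨Finset.mem_univ _, fun h => ?_⟩
    have h1 := (Cor22.ord_algebraMap_neg_iff W (Cor22.jMod P)).mpr h.1
    rw [hj] at h1
    exact absurd h1 (not_lt.mpr hWj)
  have hww : weight Fm w.1 = weight P.F W := weight_finBelow_eq_of_adjoin_eq_top htop W hW
  calc (1 / 2 : ℝ) = weight Fm w.1 := by rw [hww, hw]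
    _ ≤ _ := Finset.single_le_sum (f := fun V : placesOver Fm p => weight Fm V.1)
        (fun V _ => weight_nonneg Fm V.1) hwgood

/-- **The bad-height sum at a split prime is `≥ k·log p`.** For `P = (F_tpd, λ)` with `ℚ(j(λ)) = F_tpd` and a place `V` of `F_tpd`
over `p` with `ord_V j(λ) ≤ −2k` (`k ≥ 1`), `V ∤ 2`, `V ∤ l`, `Pr(V) = 1/2`, `n_V = 1`, `log N(V) = log p`: the `Pr`-weighted sum of
the normalised local heights `(−ord j(λ))·log N/n` over the (P5)-bad places of `ℚ(j(λ))` above `p` is at least `(1/2)·2k·log p`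
(the restriction of `V` is (P5)-bad and contributes exactly that, by abc-iut-s2-p5 gen 0's `ord_mul_logNorm_div_localDegree_algebraMap`;
all other terms are `≥ 0`). [cite: DupuyHilado2025, §3.3, §3.6] [cite: NeukirchANT1999, Ch. I §8] -/
theorem mul_log_le_badHeightSum (htop : IntermediateField.adjoin ℚ ({Cor22.jInv P.x} : Set P.F) = ⊤)
    {p : ℕ} [Fact p.Prime] {V : HeightOneSpectrum (𝓞 P.F)} (hV : V ∈ placesOver P.F p)
    {k : ℕ} (hVj : ord P.F V (Cor22.jInv P.x) ≤ -(2 * k : ℤ)) (hk : 1 ≤ k)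
    (hV2 : ((2 : ℕ) : 𝓞 P.F) ∉ V.asIdeal) (hVl : ((l : ℕ) : 𝓞 P.F) ∉ V.asIdeal)
    (hwV : weight P.F V = 1 / 2) (hnV : localDegree P.F V = 1) (hNV : logNorm P.F V = Real.log p) :
    (k : ℝ) * Real.log p ≤ ∑ V : placesOver ↥(IntermediateField.adjoin ℚ ({Cor22.jInv P.x} : Set P.F)) p,
        (if ord _ V.1 (Cor22.jMod P) < 0 ∧ ((2 : ℕ) : 𝓞 _) ∉ V.1.asIdeal ∧ ((l : ℕ) : 𝓞 _) ∉ V.1.asIdeal then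
          weight _ V.1 * (((-ord _ V.1 (Cor22.jMod P) : ℤ) : ℝ) * logNorm _ V.1 / (localDegree _ V.1 : ℝ))
         else 0) := by
  set Fm : Type := ↥(IntermediateField.adjoin ℚ ({Cor22.jInv P.x} : Set P.F)) with hFm
  let v : placesOver Fm p := ⟨finBelow Fm P.F V, finBelow_mem_placesOver Fm P.F hV⟩
  have hj : algebraMap Fm P.F (Cor22.jMod P) = Cor22.jInv P.x := rfl
  have hVneg : ord P.F V (Cor22.jInv P.x) < 0 := by omega
  have hvj : ord Fm v.1 (Cor22.jMod P) < 0 :=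
    (Cor22.ord_algebraMap_neg_iff V (Cor22.jMod P)).mp (by rw [hj]; exact hVneg)
  have hv2 : ((2 : ℕ) : 𝓞 Fm) ∉ v.1.asIdeal := fun h2 => hV2 ((Cor22.natCast_mem_asIdeal_finBelow_iff V 2).mp h2)
  have hvl : ((l : ℕ) : 𝓞 Fm) ∉ v.1.asIdeal := fun h2 => hVl ((Cor22.natCast_mem_asIdeal_finBelow_iff V l).mp h2)
  -- every term is `≥ 0`
  have hnn : ∀ U ∈ (Finset.univ : Finset (placesOver Fm p)),
      0 ≤ (if ord Fm U.1 (Cor22.jMod P) < 0 ∧ ((2 : ℕ) : 𝓞 Fm) ∉ U.1.asIdeal ∧ ((l : ℕ) : 𝓞 Fm) ∉ U.1.asIdeal then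
          weight Fm U.1 * (((-ord Fm U.1 (Cor22.jMod P) : ℤ) : ℝ) * logNorm Fm U.1 / (localDegree Fm U.1 : ℝ))
         else 0) := by
    intro U _
    split_ifs with hU
    · have ho : (0 : ℝ) ≤ ((-ord Fm U.1 (Cor22.jMod P) : ℤ) : ℝ) := by
        have : (0 : ℤ) ≤ -ord Fm U.1 (Cor22.jMod P) := by have := hU.1; omega
        exact_mod_cast this
      exact mul_nonneg (weight_nonneg Fm U.1)
        (div_nonneg (mul_nonneg ho (logNorm_pos Fm U.1).le) (Nat.cast_nonneg _))
    · exact le_rfl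
  have hsingle := Finset.single_le_sum hnn (Finset.mem_univ v)
  -- the term at `v` is `Pr(V)·(−ord_V j(λ))·log N(V)/n_V`
  have hterm : (if ord Fm v.1 (Cor22.jMod P) < 0 ∧ ((2 : ℕ) : 𝓞 Fm) ∉ v.1.asIdeal ∧ ((l : ℕ) : 𝓞 Fm) ∉ v.1.asIdeal then
          weight Fm v.1 * (((-ord Fm v.1 (Cor22.jMod P) : ℤ) : ℝ) * logNorm Fm v.1 / (localDegree Fm v.1 : ℝ))
         else 0) =
      weight P.F V * (-(ord P.F V (Cor22.jInv P.x) : ℝ) * logNorm P.F V / (localDegree P.F V : ℝ)) := by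
    rw [if_pos ⟨hvj, hv2, hvl⟩]
    have hww : weight Fm v.1 = weight P.F V := weight_finBelow_eq_of_adjoin_eq_top htop V hV
    have hh : (ord P.F V (Cor22.jInv P.x) : ℝ) * logNorm P.F V / (localDegree P.F V : ℝ) =
        (ord Fm v.1 (Cor22.jMod P) : ℝ) * logNorm Fm v.1 / (localDegree Fm v.1 : ℝ) :=
      ord_mul_logNorm_div_localDegree_algebraMap V (Cor22.jMod P)
    rw [hww]
    congr 1
    push_cast
    calc -(ord Fm v.1 (Cor22.jMod P) : ℝ) * logNorm Fm v.1 / (localDegree Fm v.1 : ℝ)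
        = -((ord Fm v.1 (Cor22.jMod P) : ℝ) * logNorm Fm v.1 / (localDegree Fm v.1 : ℝ)) := by ring
      _ = -((ord P.F V (Cor22.jInv P.x) : ℝ) * logNorm P.F V / (localDegree P.F V : ℝ)) := by rw [hh]
      _ = -(ord P.F V (Cor22.jInv P.x) : ℝ) * logNorm P.F V / (localDegree P.F V : ℝ) := by ring
  rw [hterm, hwV, hnV, hNV] at hsingle
  refine le_trans ?_ hsingle
  have hM' : (2 * k : ℝ) ≤ -(ord P.F V (Cor22.jInv P.x) : ℝ) := by
    have : (2 * k : ℤ) ≤ -ord P.F V (Cor22.jInv P.x) := by omega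
    exact_mod_cast this
  have hlogp : 0 ≤ Real.log p := Real.log_nonneg (by exact_mod_cast (Fact.out : p.Prime).one_lt.le)
  push_cast
  rw [div_one]
  nlinarith

/-! ## §3. The real-arithmetic endgame -/

/-- **The sharp slack is beaten.** Pure real arithmetic: with `d = 2`, `l ≥ 11`, `0 ≤ lD`, `0 ≤ lC ≤ h`, `h^{1/2} ≤ l ≤ 10δ·h^{1/2}·log(2δh)`,
`h ≤ A + B·k` (`B > 0`), `k·log 7 ≤ S`, `1/2 ≤ ω`, `E ≤ 34·δ·l + 52` and the growth inequality
`8·lD + 13 + A·log 7/(48B) + (33/4)·h^{1/2} + 85·δ²·h^{1/2}·log(2δh) < (log 7/(48B))·h`: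
`(4d − 1 + 3d/l)(lD + lC) + ((l+5−4d)/(4l))·lC + ((l+1)/4)·E < (1/(2l))·S·(l(l+1)/12 − 4(1−ω)/((l−1)ω³))`. [folklore] -/
theorem sharp_violation_real {k l d lD lC h A B δ S ω E : ℝ} (hd : d = 2) (hl : 11 ≤ l) (hδ : 0 < δ)
    (hlD : 0 ≤ lD) (hlC0 : 0 ≤ lC) (hlC : lC ≤ h) (hh : 0 < h) (hlo : Real.sqrt h ≤ l)
    (hhi : l ≤ 10 * δ * Real.sqrt h * Real.log (2 * δ * h)) (hAB : h ≤ A + B * k) (hB : 0 < B)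
    (hS : k * Real.log 7 ≤ S) (hk : 0 ≤ k) (hω : 1 / 2 ≤ ω) (hE : E ≤ 34 * δ * l + 52)
    (hgrowth : 8 * lD + 13 + A * (Real.log 7 / (48 * B)) + 33 / 4 * Real.sqrt h
        + 85 * δ ^ 2 * Real.sqrt h * Real.log (2 * δ * h) < Real.log 7 / (48 * B) * h) :
    (4 * d - 1 + 3 * d / l) * (lD + lC) + (l + 5 - 4 * d) / (4 * l) * lC + (l + 1) / 4 * E <
      1 / (2 * l) * S * (l * (l + 1) / 12 - 4 * (1 - ω) / ((l - 1) * ω ^ 3)) := by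
  subst hd
  have hl0 : 0 < l := by linarith
  have hl1 : 1 ≤ l + 1 := by linarith
  have hlog7 : 0 < Real.log 7 := Real.log_pos (by norm_num)
  have hkS : 0 ≤ k * Real.log 7 := mul_nonneg hk hlog7.le
  have hS0 : 0 ≤ S := hkS.trans hS
  set s : ℝ := Real.sqrt h with hs_def
  set L : ℝ := Real.log (2 * δ * h) with hL_def
  have hsq0 : 0 ≤ s := Real.sqrt_nonneg h
  have hsqpos : 0 < s := Real.sqrt_pos.mpr hh
  -- the (Ind1)-tail: `4(1−ω)/((l−1)ω³) ≤ 16/(l−1) ≤ l(l+1)/24`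
  have hω3 : 1 / 8 ≤ ω ^ 3 := by
    have e : (ω - 1 / 2) * (ω ^ 2 + ω / 2 + 1 / 4) = ω ^ 3 - 1 / 8 := by ring
    have : 0 ≤ (ω - 1 / 2) * (ω ^ 2 + ω / 2 + 1 / 4) := mul_nonneg (by linarith) (by positivity)
    linarith
  have hω0 : 0 < ω ^ 3 := by linarith
  have htail : 4 * (1 - ω) / ((l - 1) * ω ^ 3) ≤ 16 / (l - 1) := by
    rw [div_le_div_iff₀ (mul_pos (by linarith) hω0) (by linarith)]
    have h1 : 4 * (1 - ω) * (l - 1) ≤ 2 * (l - 1) :=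
      mul_le_mul_of_nonneg_right (by linarith) (by linarith)
    have h2 : (l - 1) * (1 / 8) ≤ (l - 1) * ω ^ 3 := mul_le_mul_of_nonneg_left hω3 (by linarith)
    linarith
  have h16 : 16 / (l - 1) ≤ l * (l + 1) / 24 := by
    rw [div_le_div_iff₀ (by linarith) (by norm_num)]
    have h1 : (11 : ℝ) * 12 ≤ l * (l + 1) := mul_le_mul hl (by linarith) (by norm_num) (by linarith)
    have h2 : (11 : ℝ) * 12 * 10 ≤ l * (l + 1) * (l - 1) :=
      mul_le_mul h1 (by linarith) (by norm_num) (by positivity)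
    linarith
  have hf : l * (l + 1) / 24 ≤ l * (l + 1) / 12 - 4 * (1 - ω) / ((l - 1) * ω ^ 3) := by linarith
  have hf0 : 0 ≤ l * (l + 1) / 24 := by positivity
  -- lower bound of the mixed side: `(l+1)·k·log 7/48`
  have hmix : k * Real.log 7 * (l + 1) / 48 ≤
      1 / (2 * l) * S * (l * (l + 1) / 12 - 4 * (1 - ω) / ((l - 1) * ω ^ 3)) := by
    have h1 : k * Real.log 7 * (l * (l + 1) / 24) ≤ S * (l * (l + 1) / 12 - 4 * (1 - ω) / ((l - 1) * ω ^ 3)) :=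
      mul_le_mul hS hf hf0 hS0
    have e : k * Real.log 7 * (l + 1) / 48 = 1 / (2 * l) * (k * Real.log 7 * (l * (l + 1) / 24)) := by
      field_simp
      ring
    rw [e, mul_assoc (1 / (2 * l))]
    exact mul_le_mul_of_nonneg_left h1 (by positivity)
  -- upper bound of the slack side
  have hc1 : (4 * 2 - 1 + 3 * 2 / l) * (lD + lC) ≤ 8 * (lD + lC) := by
    have h6l : 6 / l ≤ 1 := by rw [div_le_one hl0]; linarith
    have : 4 * 2 - 1 + 3 * 2 / l ≤ (8 : ℝ) := by
      have e : (3 : ℝ) * 2 / l = 6 / l := by ring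
      rw [e]; linarith
    exact mul_le_mul_of_nonneg_right this (by positivity)
  have hc2 : (l + 5 - 4 * 2) / (4 * l) * lC ≤ 1 / 4 * lC := by
    have : (l + 5 - 4 * 2) / (4 * l) ≤ (1 : ℝ) / 4 := by
      rw [div_le_div_iff₀ (by positivity) (by norm_num)]
      linarith
    exact mul_le_mul_of_nonneg_right this hlC0
  have hc3 : (l + 1) / 4 * E ≤ (l + 1) / 4 * (34 * δ * l + 52) := mul_le_mul_of_nonneg_left hE (by positivity)
  have hstep1 : (4 * 2 - 1 + 3 * 2 / l) * (lD + lC) + (l + 5 - 4 * 2) / (4 * l) * lC + (l + 1) / 4 * E ≤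
      8 * (lD + lC) + 1 / 4 * lC + (l + 1) / 4 * (34 * δ * l + 52) := by linarith
  -- `L = log(2δh) ≥ 0` (else `l ≤ 10δ·s·L < 0`)
  have hL0 : 0 ≤ L := by
    by_contra hneg
    have hneg' : L < 0 := lt_of_not_ge hneg
    have : 10 * δ * s * L < 0 := mul_neg_of_pos_of_neg (by positivity) hneg'
    linarith
  -- every slack term against a multiple of `l + 1`
  have hA1 : lD ≤ lD * (l + 1) := le_mul_of_one_le_right hlD hl1
  have hhs : h = s * s := (Real.mul_self_sqrt hh.le).symm
  have hss : s * s ≤ s * (l + 1) := mul_le_mul_of_nonneg_left (by linarith) hsq0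
  have hA2 : lC ≤ s * (l + 1) := by linarith
  have hA3 : δ * l * (l + 1) ≤ δ * (10 * δ * s * L) * (l + 1) :=
    mul_le_mul_of_nonneg_right (mul_le_mul_of_nonneg_left hhi hδ.le) (by linarith)
  have e4 : (l + 1) / 4 * (34 * δ * l + 52) = 17 / 2 * (δ * l * (l + 1)) + 13 * (l + 1) := by ring
  have e5 : δ * (10 * δ * s * L) * (l + 1) = 10 * (δ ^ 2 * s * L * (l + 1)) := by ring
  -- the growth inequality gives `8lD + 13 + (33/4)s + 85δ²sL < k·log 7/48`
  have hkey : 8 * lD + 13 + 33 / 4 * s + 85 * δ ^ 2 * s * L < k * Real.log 7 / 48 := by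
    have hκ : 0 < Real.log 7 / (48 * B) := by positivity
    have h1 : Real.log 7 / (48 * B) * h ≤ Real.log 7 / (48 * B) * (A + B * k) :=
      mul_le_mul_of_nonneg_left hAB hκ.le
    have e : Real.log 7 / (48 * B) * (A + B * k) = A * (Real.log 7 / (48 * B)) + k * Real.log 7 / 48 := by
      field_simp
    linarith
  have hkey' := mul_lt_mul_of_pos_right hkey (by linarith : (0 : ℝ) < l + 1)
  have e7 : (8 * lD + 13 + 33 / 4 * s + 85 * δ ^ 2 * s * L) * (l + 1) =
      8 * (lD * (l + 1)) + 13 * (l + 1) + 33 / 4 * (s * (l + 1)) + 85 * (δ ^ 2 * s * L * (l + 1)) := by ring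
  have e8 : k * Real.log 7 / 48 * (l + 1) = k * Real.log 7 * (l + 1) / 48 := by ring
  linarith

end PointDict

end Summit.ABC.IUTFork

end
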